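import Summits.Ventures.CertifiedQuantumChemistry.Certificates.HubbardRingL4SingletDualFamily
import HarnessLib

/-!
# Ventures/CertifiedQuantumChemistry — Certificates/HubbardRingL4SectorDualPairPoly.lean: block families `S(ε)·(P_r + √2·P_s)·S(ε)ᵀ`
# over `ℚ(√2)` from RATIONAL kernel verdicts — positive semidefiniteness of `P_r + √2·P_s` by convexity between two rational points
# `q₁ ≤ √2 ≤ q₂` (two `ExactLDL` runs), the `ε`-expansion tables of the two parts, and their scatter into the `64 × 64` index set

HONEST FRAMING (verbatim): certified bounds for a stated model Hamiltonian in a stated basis; not a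
claim about the real molecule beyond that model. A CERTIFICATE FORMAT statement: no model value, no row, no claim node.

Seat rdm-B (gen 45); the `ℚ(√2)` companion of `Certificates/HubbardRingL4SectorDualPoly.lean` §2 (gen 44). A dual block of the
level-DQG certificate family of the 4-ring is `Z(ε) = S(ε)·P·S(ε)ᵀ` with RATIONAL polynomial columns `S(ε) = S₀ + εS₁ + ε²S₂` and a
constant core `P = P_r + √2·P_s` (`P_r`, `P_s` rational, symmetric). This file avoids all `ℚ(√2)` arithmetic inside the kernel:
* §1 `posSemidef_add_sqrt_two_smul` — if `A + q₁B ⪰ 0` and `A + q₂B ⪰ 0` with `q₁ ≤ √2 ≤ q₂` then `A + √2·B ⪰ 0` (the segment is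
  convex); `posSemidef_ratCast_add_sqrt_two_smul` — the same from two `ExactLDL.ldlAccept` verdicts on the rational matrices
  `P_r + q₁•P_s`, `P_r + q₂•P_s` (`0 ≤ q₁`, `q₁² ≤ 2 ≤ q₂²`, decidable);
* §2 **`posSemidef_realPoly_pair_of_tables`** — with the shipped tables `R_• d = P_•·(S d)ᵀ`, `T_• m = Σ_{d₁+d₂=m} S d₁·R_• d₂`
  (`• = r, s`; kernel identities as in gen 44's block files): `realPoly T_r ε + √2 • realPoly T_s ε = S(ε)·(P_r + √2 P_s)·S(ε)ᵀ ⪰ 0`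
  for every real `ε`;
* §3 `scatter_add_smul`, **`realZ_pair_scatter`** (with gen 44's `Singlet.realZ_sum_scatter`) — the combined real table of a pair of scattered polynomial
  families is the scatter of `realPoly T_r ε + √2 • realPoly T_s ε` (the shape `Dual.le_of_check_sector_pair` consumes).
0 sorry, 0 def; standard axioms. References (docstring-only): R. A. Horn, C. R. Johnson, Matrix Analysis (2nd ed.) Obs. 7.1.8,
§7.1 (the positive semidefinite cone is convex; congruence preserves it).
-/

set_option linter.style.longLine false

namespace Summit.Ventures.CertifiedQuantumChemistry

namespace DualL4

open Matrix Finset BlockScatter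

/-! ## §1 `A + √2·B ⪰ 0` from two rational points of the segment -/

section Segment

variable {ι : Type*}

/-- **Convexity along `q₁ ≤ √2 ≤ q₂`.** If `A + q₁•B` and `A + q₂•B` are positive semidefinite then so is `A + √2•B`. -/
theorem posSemidef_add_sqrt_two_smul {A B : Matrix ι ι ℝ} {q₁ q₂ : ℝ} (h1 : q₁ ≤ Real.sqrt 2) (h2 : Real.sqrt 2 ≤ q₂)
    (hA1 : (A + q₁ • B).PosSemidef) (hA2 : (A + q₂ • B).PosSemidef) : (A + Real.sqrt 2 • B).PosSemidef := by
  rcases eq_or_lt_of_le (h1.trans h2) with h | h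
  · have e : Real.sqrt 2 = q₁ := le_antisymm (h ▸ h2) h1
    rw [e]; exact hA1
  · set l : ℝ := (q₂ - Real.sqrt 2) / (q₂ - q₁) with hl
    have hden : 0 < q₂ - q₁ := sub_pos.2 h
    have hl0 : 0 ≤ l := div_nonneg (sub_nonneg.2 h2) hden.le
    have hl1 : 0 ≤ 1 - l := by
      rw [hl, sub_nonneg, div_le_one hden]; linarith
    have hcomb : l * q₁ + (1 - l) * q₂ = Real.sqrt 2 := by
      rw [hl]; field_simp; ring
    have e : A + Real.sqrt 2 • B = l • (A + q₁ • B) + (1 - l) • (A + q₂ • B) := by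
      ext i j
      simp only [Matrix.add_apply, Matrix.smul_apply, smul_eq_mul]
      rw [← hcomb]; ring
    rw [e]
    exact (hA1.smul hl0).add (hA2.smul hl1)

/-- **The rational form.** Two `ExactLDL` verdicts at rational `q₁, q₂` with `0 ≤ q₁`, `q₁² ≤ 2`, `0 ≤ q₂`, `2 ≤ q₂²` on symmetric
rational `P_r`, `P_s` give `P_r + √2·P_s ⪰ 0` over `ℝ`. -/
theorem posSemidef_ratCast_add_sqrt_two_smul {r : ℕ} (Pr Ps : Matrix (Fin r) (Fin r) ℚ) (q₁ q₂ : ℚ)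
    (hq₁ : 0 ≤ q₁) (hq₁' : q₁ ^ 2 ≤ 2) (hq₂ : 0 ≤ q₂) (hq₂' : 2 ≤ q₂ ^ 2)
    (hr : ∀ k l : Fin r, Pr k l = Pr l k) (hs : ∀ k l : Fin r, Ps k l = Ps l k)
    (hacc1 : ExactLDL.ldlAccept r (Pr + q₁ • Ps) = true) (hacc2 : ExactLDL.ldlAccept r (Pr + q₂ • Ps) = true) :
    (Pr.map (Rat.cast : ℚ → ℝ) + Real.sqrt 2 • Ps.map (Rat.cast : ℚ → ℝ)).PosSemidef := by
  have sy : ∀ q : ℚ, (Pr + q • Ps).IsSymm := fun q =>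
    Matrix.IsSymm.ext fun k l => by simp [Matrix.add_apply, Matrix.smul_apply, hr l k, hs l k]
  have h1 := (ExactLDL.ldlAccept_iff_posSemidef_real _ (sy q₁)).mp hacc1
  have h2 := (ExactLDL.ldlAccept_iff_posSemidef_real _ (sy q₂)).mp hacc2
  have cast : ∀ q : ℚ, (Pr + q • Ps).map (Rat.cast : ℚ → ℝ) = Pr.map (Rat.cast : ℚ → ℝ) + ((q : ℚ) : ℝ) • Ps.map (Rat.cast : ℚ → ℝ) := by
    intro q; ext k l; simp [Matrix.add_apply, Matrix.smul_apply]
  rw [cast] at h1 h2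
  refine posSemidef_add_sqrt_two_smul ?_ ?_ h1 h2
  · have e : ((q₁ : ℚ) : ℝ) = Real.sqrt (((q₁ : ℚ) : ℝ) ^ 2) := (Real.sqrt_sq (by exact_mod_cast hq₁)).symm
    rw [e]
    exact Real.sqrt_le_sqrt (by exact_mod_cast hq₁')
  · have e : ((q₂ : ℚ) : ℝ) = Real.sqrt (((q₂ : ℚ) : ℝ) ^ 2) := (Real.sqrt_sq (by exact_mod_cast hq₂)).symm
    rw [e]
    exact Real.sqrt_le_sqrt (by exact_mod_cast hq₂')

end Segment

/-! ## §2 Block families `S(ε)·(P_r + √2·P_s)·S(ε)ᵀ` from kernel-decidable table identities -/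

section Blocks

variable {dim r : ℕ}

/-- **A `ℚ(√2)` block family is positive semidefinite** once the two rational segment points of its core are accepted by `ExactLDL`
and the shipped tables of BOTH parts satisfy the two kernel identities of `DualL4.realPoly_eq`. -/
theorem posSemidef_realPoly_pair_of_tables (S : Fin 3 → Matrix (Fin dim) (Fin r) ℚ) (Pr Ps : Matrix (Fin r) (Fin r) ℚ)
    (Rr Rs : Fin 3 → Matrix (Fin r) (Fin dim) ℚ) (Tr Ts : Fin 5 → Matrix (Fin dim) (Fin dim) ℚ) (q₁ q₂ : ℚ)
    (hq₁ : 0 ≤ q₁) (hq₁' : q₁ ^ 2 ≤ 2) (hq₂ : 0 ≤ q₂) (hq₂' : 2 ≤ q₂ ^ 2)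
    (hr : ∀ k l : Fin r, Pr k l = Pr l k) (hs : ∀ k l : Fin r, Ps k l = Ps l k)
    (hacc1 : ExactLDL.ldlAccept r (Pr + q₁ • Ps) = true) (hacc2 : ExactLDL.ldlAccept r (Pr + q₂ • Ps) = true)
    (hRr : ∀ (d : Fin 3) (k : Fin r) (b : Fin dim), Rr d k b = ∑ l : Fin r, Pr k l * S d b l)
    (hRs : ∀ (d : Fin 3) (k : Fin r) (b : Fin dim), Rs d k b = ∑ l : Fin r, Ps k l * S d b l)
    (hTr : ∀ (m : Fin 5) (a b : Fin dim), Tr m a b = polyConv S Rr m a b)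
    (hTs : ∀ (m : Fin 5) (a b : Fin dim), Ts m a b = polyConv S Rs m a b) (ε : ℝ) :
    (realPoly Tr ε + Real.sqrt 2 • realPoly Ts ε).PosSemidef := by
  rw [realPoly_eq S Pr Rr Tr hRr hTr ε, realPoly_eq S Ps Rs Ts hRs hTs ε]
  have e : realS S ε * Pr.map (Rat.cast : ℚ → ℝ) * (realS S ε)ᵀ + Real.sqrt 2 • (realS S ε * Ps.map (Rat.cast : ℚ → ℝ) * (realS S ε)ᵀ)
      = realS S ε * (Pr.map (Rat.cast : ℚ → ℝ) + Real.sqrt 2 • Ps.map (Rat.cast : ℚ → ℝ)) * (realS S ε)ᵀ := by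
    rw [Matrix.mul_add, Matrix.add_mul, Matrix.mul_smul, Matrix.smul_mul]
  rw [e]
  have hP := posSemidef_ratCast_add_sqrt_two_smul Pr Ps q₁ q₂ hq₁ hq₁' hq₂ hq₂' hr hs hacc1 hacc2
  have h := hP.mul_mul_conjTranspose_same (realS S ε)
  rwa [Matrix.conjTranspose_eq_transpose_of_trivial] at h

end Blocks

/-! ## §3 Scattering a pair of polynomial block families into the `64 × 64` index set -/

section Scatter

/-- The scatter of real blocks is linear. -/
theorem scatter_add_smul {k : ℕ} (lab pos : OP → ℕ) (X Y : Matrix (Fin k) (Fin k) ℝ) (c : ℝ) :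
    scatter k lab pos 1 (X + c • Y) = scatter k lab pos 1 X + c • scatter k lab pos 1 Y := by
  ext P R
  simp only [scatter_apply, Matrix.add_apply, Matrix.smul_apply, smul_eq_mul]
  split_ifs <;> simp

/-- **The combined real table of a scattered pair** is the scatter of `realPoly T_r ε + √2 • realPoly T_s ε`. -/
theorem realZ_pair_scatter {k : ℕ} (Tr Ts : Fin 5 → Matrix (Fin k) (Fin k) ℚ) (lab pos : OP → ℕ) (ε : ℚ) :
    Dual.realZ (fun P R => ∑ m : Fin 5, ε ^ (m : ℕ) * scatter k lab pos 1 (Tr m) P R)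
      + Real.sqrt 2 • Dual.realZ (fun P R => ∑ m : Fin 5, ε ^ (m : ℕ) * scatter k lab pos 1 (Ts m) P R)
      = scatter k lab pos 1 (realPoly Tr (ε : ℝ) + Real.sqrt 2 • realPoly Ts (ε : ℝ)) := by
  rw [Singlet.realZ_sum_scatter, Singlet.realZ_sum_scatter, scatter_add_smul]

/-- **Positivity of a scattered pair family** from the block verdict. -/
theorem posSemidef_realZ_pair_scatter {k : ℕ} (Tr Ts : Fin 5 → Matrix (Fin k) (Fin k) ℚ) (lab pos : OP → ℕ)
    (h : ∀ ε : ℝ, (realPoly Tr ε + Real.sqrt 2 • realPoly Ts ε).PosSemidef) (ε : ℚ) :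
    (Dual.realZ (fun P R => ∑ m : Fin 5, ε ^ (m : ℕ) * scatter k lab pos 1 (Tr m) P R)
      + Real.sqrt 2 • Dual.realZ (fun P R => ∑ m : Fin 5, ε ^ (m : ℕ) * scatter k lab pos 1 (Ts m) P R)).PosSemidef := by
  rw [realZ_pair_scatter]
  exact posSemidef_scatter _ _ _ _ (h _)

end Scatter

end DualL4

end Summit.Ventures.CertifiedQuantumChemistry
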